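import Summits.SmoothPoincare4.SmoothPoincare4.Theorems.EntropyRungCompactShrinkerGapScalarIdentities
import Summits.SmoothPoincare4.SmoothPoincare4.Theorems.EntropyRungCompactShrinkerGapJensenVolumeBound
import Literature.Geometry.Lorentzian.HessianLocalMax
import Literature.Geometry.Lorentzian.MetricNormSq
import Mathlib.Topology.Homotopy.Equiv
import HarnessLib

/-!
# The pointwise sufficient condition `R ≤ 2.48` for the variance budget of line `cgy-variance-pivot`
(crux `EntropyRung.CompactShrinkerGap`, item stmt-SmoothPoincare4-10870)

The line reduces the crux to ONE inequality among the soliton integrals of a closed normalised 4-d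
gradient shrinker `Ric + Hess f = g/2`, `R + |∇f|² = f` of Gaussian mass
`Z = ∫e^{-f} dV > Z₀ = 32π²√π e^{-3/2}` on a homotopy 4-sphere: the VARIANCE BUDGET
`D := ∫(R − 2)² dV < 2V − 96π²` (`V = Vol(M, g)`; registered stub `stub_varianceBudget`, the open
transfer target). This file records, as the registered stub `stub_varianceBudget_of_scalarCurvature_le`, the
second of the two honest SUFFICIENT CONDITIONS that the density hypothesis buys today (the first,
the Einstein sub-case, is `stub_varianceBudget_of_einstein` of
`EntropyRungCompactShrinkerGapVarianceBudgetEinstein.lean`; its volume-floor numerics are repeated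
here privately so that the two files are independent):

* the EINSTEIN sub-case `Hess f ≡ 0`: then `Ric = g/2`, `R = 2` (`R + Δf = 2` with `Δf = tr 0 = 0`),
  so `D = 0`, and the volume floor `V > e²Z₀ = 32π²√π e^{1/2} ≈ 93.5π²`
  (`volume_floor_of_density`, from the Jensen argument `∫fe^{-f} = 2∫e^{-f}`) gives
  `0 < 2V − 96π²` (Cao–Hamilton–Ilmanen 2004, §4: `Θ(S⁴) = 6/e² > Θ(S³×ℝ)`; the refuter's
  `einstein_budget_iff`: in the Einstein class the budget is exactly `V > 48π²`);
* the POINTWISE condition `R ≤ 2.48`: a closed shrinker has `R ≥ 0` (weak minimum principle: at a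
  global minimum `x₀` of `R`, `ΔR ≥ 0` and `dR = 0`, so `R(x₀) = ΔR + 2|Ric|² ≥ 0` by the identity
  `ΔR = g⁻¹(dR, df) + R − 2|Ric|²` of `stub_shrinkerScalarIdentities`; the strict positivity of
  `stub_scalarCurvaturePos_of_identities` is not needed), so
  `(R − 2)² = R² − 4R + 4 ≤ (c − 4)R + 4` for `0 ≤ R ≤ c`, and `∫R dV = 2V` (`R + Δf = 2`,
  `∫Δf dV = 0`), whence `D ≤ 2(c − 2)V = 0.96·V < 2V − 96π²` as soon as `V > 96π²/1.04 ≈ 92.3π²`,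
  which the same volume floor provides (Cheng–Ribeiro–Zhou 2023, Rem. 2: `∫R² ≤ R_max∫R`; the
  threshold is `c < 3 − 48π²/V`, `≈ 2.486` at the floor).

Everything here is proved (no `sorry`, no named fact).

## References

* H.-D. Cao, R. S. Hamilton, T. Ilmanen, *Gaussian densities and stability for some Ricci
  solitons*, arXiv:math/0404165 (2004), §4. [CaoHamiltonIlmanen2004]
* X. Cheng, E. Ribeiro Jr., D. Zhou, *On four-dimensional compact gradient shrinking Ricci solitons*
  (arXiv:2203.14916), Rem. 2. [ChengRibeiroZhou2022]
-/

noncomputable section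

-- the registered namespace `Summit.SmoothPoincare4.SmoothPoincare4.Theorems` repeats a component
set_option linter.dupNamespace false

open Bundle Set Function Filter Module MeasureTheory
open scoped Manifold ContDiff Topology ENNReal ContinuousMap

namespace Summit.SmoothPoincare4.SmoothPoincare4.Theorems

open Literature.Geometry Literature.Geometry.Lorentzian Literature.Geometry.Riemannian
  Literature.Geometry.Lorentzian.PseudoRiemannianMetric

/-- (Local copy of the lemma of `EntropyRungCompactShrinkerGapVarianceBudgetEinstein.lean`, kept
private so that this file does not depend on that module.) **Numerics of the volume floor**: `2.9 < √π · e^{1/2}` (`√π > 1.77245`, `e^{1/2} > 1.6487`,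
product `≈ 2.9222`). [folklore] -/
private theorem two_point_nine_lt_sqrt_pi_mul_exp_half_aux : (2.9 : ℝ) < Real.sqrt Real.pi * Real.exp (1 / 2) := by
  have hs : (1.77245 : ℝ) < Real.sqrt Real.pi := by
    rw [Real.lt_sqrt (by norm_num)]
    have := Real.pi_gt_d6
    nlinarith
  have ht : (1.6487 : ℝ) < Real.exp (1 / 2) := by
    have h : (1.6487 : ℝ) ^ 2 < Real.exp (1 / 2) ^ 2 := by
      rw [← Real.exp_nat_mul]
      norm_num
      have := Real.exp_one_gt_d9
      linarith
    exact lt_of_pow_lt_pow_left₀ 2 (Real.exp_pos _).le h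
  calc (2.9 : ℝ) < 1.77245 * 1.6487 := by norm_num
    _ < Real.sqrt Real.pi * Real.exp (1 / 2) := mul_lt_mul'' hs ht (by norm_num) (by norm_num)

/-- (Local copy, private.) **The volume floor in the form `92.8π² < V`** for the crux data (from
`volume_floor_of_density`: `V > 32π²√π e^{1/2}` and `√π e^{1/2} > 2.9`).
[cite: CaoHamiltonIlmanen2004, §4] -/
private theorem volume_floor_numeric_aux
    (M : Type) [TopologicalSpace M] [T2Space M] [SecondCountableTopology M]
    [ChartedSpace (EuclideanSpace ℝ (Fin 4)) M] [IsManifold (𝓡 4) ∞ M] [CompactSpace M]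
    [T3Space M] [MeasurableSpace M] [BorelSpace M]
    (g : Literature.Geometry.Lorentzian.PseudoRiemannianMetric (𝓡 4) ∞ (EuclideanSpace ℝ (Fin 4))
      (TangentSpace (𝓡 4) : M → Type _)) [g.HasLeviCivita] (f : M → ℝ) (hg : g.IsRiemannian)
    (hf : ContMDiff (𝓡 4) 𝓘(ℝ, ℝ) ∞ f)
    (hsol : ∀ (x : M) (X Y : TangentSpace (𝓡 4) x),
      g.ricci x X Y + g.hessian f x X Y = (1 / 2 : ℝ) * g.val x X Y)
    (hnorm : ∀ x : M, g.scalarCurvature x + g.gradSq f x = f x)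
    (hdens : ENNReal.ofReal (32 * Real.pi ^ 2 * Real.sqrt Real.pi * Real.exp (-(3 : ℝ) / 2)) <
      ∫⁻ x, ENNReal.ofReal (Real.exp (-f x))
        ∂(Literature.Geometry.Lorentzian.riemannianMeasure (g.toContMDiffRiemannianMetric hg))) :
    92.8 * Real.pi ^ 2 <
      ((Literature.Geometry.Lorentzian.riemannianMeasure (g.toContMDiffRiemannianMetric hg))
        Set.univ).toReal := by
  have hV := volume_floor_of_density M g f hg hf hsol hnorm hdens
  have hπ : 0 < 32 * Real.pi ^ 2 := by positivity
  have h29 := two_point_nine_lt_sqrt_pi_mul_exp_half_aux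
  calc 92.8 * Real.pi ^ 2 = 32 * Real.pi ^ 2 * 2.9 := by ring
    _ < 32 * Real.pi ^ 2 * (Real.sqrt Real.pi * Real.exp (1 / 2)) := mul_lt_mul_of_pos_left h29 hπ
    _ = 32 * Real.pi ^ 2 * Real.sqrt Real.pi * Real.exp (1 / 2) := by ring
    _ < _ := hV

/-- **STUB 1b of line `cgy-variance-pivot` — the variance budget under the pointwise bound
`R ≤ 2.48`.** For the crux data with `R ≤ 2.48` everywhere: `0 ≤ R` on a closed gradient shrinker
(weak minimum principle at a global minimum of `R`, `dalembertian_nonneg_of_isLocalMin`, with the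
identity (B) `ΔR = g⁻¹(dR, df) + R − 2|Ric|²` from `stub_shrinkerScalarIdentities` and `|Ric|² ≥ 0`,
`normSq_nonneg`), so `(R − 2)² ≤ (2.48 − 4)R + 4` pointwise; `∫R dV = 2·Vol` (`R + Δf = 2` and `∫Δf dV = 0`,
`integral_dalembertian_riemVolume_eq_zero`); hence `∫(R − 2)² dV ≤ 0.96·Vol`, which is
`< 2·Vol − 96π²` because `Vol > 92.8π²` (`volume_floor_of_density` and `2.9 < √π e^{1/2}`). The homotopy equivalence is not
used. [cite: ChengRibeiroZhou2022, Rem. 2] -/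
theorem stub_varianceBudget_of_scalarCurvature_le :
    ∀ (M : Type) [TopologicalSpace M] [T2Space M] [SecondCountableTopology M]
      [ChartedSpace (EuclideanSpace ℝ (Fin 4)) M] [IsManifold (𝓡 4) ∞ M] [CompactSpace M]
      [T3Space M] [MeasurableSpace M] [BorelSpace M],
      M ≃ₕ Metric.sphere (0 : EuclideanSpace ℝ (Fin 5)) 1 →
    ∀ (g : Literature.Geometry.Lorentzian.PseudoRiemannianMetric (𝓡 4) ∞ (EuclideanSpace ℝ (Fin 4))
        (TangentSpace (𝓡 4) : M → Type _)) [g.HasLeviCivita] (f : M → ℝ) (hg : g.IsRiemannian),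
      ContMDiff (𝓡 4) 𝓘(ℝ, ℝ) ∞ f →
      (∀ (x : M) (X Y : TangentSpace (𝓡 4) x),
        g.ricci x X Y + g.hessian f x X Y = (1 / 2 : ℝ) * g.val x X Y) →
      (∀ x : M, g.scalarCurvature x + g.gradSq f x = f x) →
      ENNReal.ofReal (32 * Real.pi ^ 2 * Real.sqrt Real.pi * Real.exp (-(3 : ℝ) / 2)) <
        ∫⁻ x, ENNReal.ofReal (Real.exp (-f x))
          ∂(Literature.Geometry.Lorentzian.riemannianMeasure (g.toContMDiffRiemannianMetric hg)) →
      (∀ x : M, g.scalarCurvature x ≤ 2.48) →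
      ∫ x, (g.scalarCurvature x - 2) ^ 2
          ∂(Literature.Geometry.Lorentzian.riemannianMeasure (g.toContMDiffRiemannianMetric hg)) <
        2 * ((Literature.Geometry.Lorentzian.riemannianMeasure (g.toContMDiffRiemannianMetric hg))
              Set.univ).toReal - 96 * Real.pi ^ 2 := by
  intro M _ _ _ _ _ _ _ _ _ _ g _ f hg hf hsol hnorm hdens hRle
  have hEfin : finrank ℝ (EuclideanSpace ℝ (Fin 4)) = 4 := finrank_euclideanSpace_fin
  have hshr : g.IsGradientShrinker f 1 := (g.isGradientShrinker_one_iff f).2 hsol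
  -- regularity of `R`
  have hR : ContMDiff (𝓡 4) 𝓘(ℝ, ℝ) ∞ g.scalarCurvature := g.contMDiff_scalarCurvature
  have hRc : Continuous g.scalarCurvature := hR.continuous
  have hRm2 : ContMDiff (𝓡 4) 𝓘(ℝ, ℝ) 2 g.scalarCurvature := hR.of_le (WithTop.coe_le_coe.mpr le_top)
  -- `R ≥ 0`: weak minimum principle at a global minimum of `R`, with the identity (B) (landed stub)
  obtain ⟨_, hB⟩ := stub_shrinkerScalarIdentities M g f hg hf hsol
  have hRpos : ∀ x : M, 0 ≤ g.scalarCurvature x := by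
    by_cases hM : Nonempty M
    · obtain ⟨x⟩ := hM
      obtain ⟨x₀, -, hmin⟩ := isCompact_univ.exists_isMinOn ⟨x, mem_univ x⟩ hRc.continuousOn
      have hloc : IsLocalMin g.scalarCurvature x₀ :=
        Filter.Eventually.of_forall fun y ↦ hmin (mem_univ y)
      have hΔ : 0 ≤ g.dalembertian g.scalarCurvature x₀ :=
        g.dalembertian_nonneg_of_isLocalMin (hRm2 x₀) hloc (fun v hv ↦ hg x₀ v hv)
      have hcrit : mfderiv (𝓡 4) 𝓘(ℝ, ℝ) g.scalarCurvature x₀ = 0 :=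
        Literature.Topology.FourManifolds.IsLocalMin.isMCriticalPt hloc
      have hd : mvfderiv (𝓡 4) g.scalarCurvature x₀ = 0 := by
        ext v
        simp [mvfderiv, hcrit]
      have hI : g.innerDual x₀
          (mvfderiv (𝓡 4) g.scalarCurvature x₀ : TangentSpace (𝓡 4) x₀ →ₗ[ℝ] ℝ)
          (mvfderiv (𝓡 4) f x₀ : TangentSpace (𝓡 4) x₀ →ₗ[ℝ] ℝ) = 0 := by
        simp [PseudoRiemannianMetric.innerDual, hd]
      have hBx := hB x₀
      rw [hI] at hBx
      have hQ : 0 ≤ g.normSq x₀ (g.ricci x₀) := g.normSq_nonneg x₀ hg _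
      intro y
      have h1 : g.scalarCurvature x₀ ≤ g.scalarCurvature y := hmin (mem_univ y)
      linarith
    · intro y
      exact (hM ⟨y⟩).elim
  -- work with `g.riemVolume`, a finite measure
  have hVeq : g.riemVolume = riemannianMeasure (g.toContMDiffRiemannianMetric hg) :=
    PseudoRiemannianMetric.riemVolume_eq hg
  haveI : IsFiniteMeasure g.riemVolume := ⟨g.riemVolume_univ_lt_top⟩
  have hV := volume_floor_numeric_aux M g f hg hf hsol hnorm hdens
  rw [← hVeq] at hV ⊢
  -- integrability
  have hf2 : ContMDiff (𝓡 4) 𝓘(ℝ, ℝ) 2 f := hf.of_le (WithTop.coe_le_coe.mpr le_top)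
  have iR : Integrable g.scalarCurvature g.riemVolume := g.integrable_of_continuous hRc
  have iD : Integrable (fun x ↦ (g.scalarCurvature x - 2) ^ 2) g.riemVolume :=
    g.integrable_of_continuous ((hRc.sub continuous_const).pow 2)
  have iL : Integrable (fun x ↦ (2.48 - 4) * g.scalarCurvature x + 4) g.riemVolume :=
    (iR.const_mul _).add (integrable_const _)
  -- the traced soliton equation `R + Δf = 2`, hence `∫ R = 2 Vol`
  have hΔf : ∀ x, g.dalembertian f x = 2 - g.scalarCurvature x := fun x ↦ by
    have h := hshr.scalarCurvature_add_dalembertian_one x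
    rw [hEfin] at h
    norm_num at h
    linarith
  have e1 : ∫ x, g.scalarCurvature x ∂g.riemVolume = 2 * (g.riemVolume univ).toReal := by
    have h0 := integral_dalembertian_riemVolume_eq_zero g hg hf2
    simp_rw [hΔf] at h0
    rw [integral_sub (integrable_const _) iR, integral_const, smul_eq_mul, Measure.real] at h0
    linarith
  -- pointwise `(R − 2)² ≤ (c − 4)R + 4` for `0 ≤ R ≤ c`, integrated
  have hpt : ∀ x, (g.scalarCurvature x - 2) ^ 2 ≤ (2.48 - 4) * g.scalarCurvature x + 4 := fun x ↦ by
    nlinarith [hRpos x, hRle x]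
  have e2 : ∫ x, (g.scalarCurvature x - 2) ^ 2 ∂g.riemVolume ≤
      (2.48 - 4) * (2 * (g.riemVolume univ).toReal) + 4 * (g.riemVolume univ).toReal := by
    calc ∫ x, (g.scalarCurvature x - 2) ^ 2 ∂g.riemVolume
        ≤ ∫ x, ((2.48 - 4) * g.scalarCurvature x + 4) ∂g.riemVolume := integral_mono iD iL hpt
      _ = (2.48 - 4) * (2 * (g.riemVolume univ).toReal) + 4 * (g.riemVolume univ).toReal := by
          rw [integral_add (iR.const_mul _) (integrable_const _), integral_const_mul, e1,
            integral_const, smul_eq_mul, Measure.real]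
          ring
  nlinarith [e2, hV, Real.pi_pos]

end Summit.SmoothPoincare4.SmoothPoincare4.Theorems
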